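import Literature.Analysis.FluidPDE.KatoLocalBoundedProofs
import Literature.Analysis.FluidPDE.KatoLerayHopf
import Literature.Analysis.FluidPDE.NSSerrinUniqueness
import Literature.Analysis.FluidPDE.ClassicalSolution
import Literature.Analysis.FluidPDE.NSLerayBlowupRateLpProofs
import HarnessLib

/-!
# The early window: classical Leray–Hopf solutions with bounded datum stay bounded for a
# time `c₀ ν / ‖u₀‖_∞²`

Analysis/FluidPDE proof file (theorems only, everything proved). For `ν > 0` let `(u, p)` be a
classical solution of the unforced Navier–Stokes system on `ℝ³ × [0, T)` which is a Leray–Hopf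
weak solution on `[0, T)` from its own initial slice `u 0`, and let `‖u(0, x)‖ ≤ B₀` for all `x`
(`B₀ > 0`). Then
`‖u(t, x)‖ ≤ 2 B₀` for all `x` and all `t ∈ [0, T)` with `t < c₀ ν / B₀²`,
with ONE absolute constant `c₀ > 0` (`exists_earlyWindow_norm_le`): the quantitative short-time
`L^∞` bound of the mild (Kato–Oseen) theory, transferred to every classical Leray–Hopf solution by
weak–strong uniqueness. No decay hypothesis on the datum beyond what the two solution notions
already carry is needed (`u 0 ∈ L²` from the Leray–Hopf class and `‖u 0‖ ≤ B₀` give `u 0 ∈ L³`;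
weak divergence-freeness of the datum is a Leray–Hopf consequence).

## Proof

1. `a = u 0 ∈ L² ∩ L^∞ ⊆ L³` is weakly divergence free (`IsLerayHopfOn.isWeaklyDivFree_datum`).
2. **Kato–Oseen for bounded data** (`kato_local_bounded_holds`; Lemarié-Rieusset 2016, Thm. 5.1,
   §9.9): a Kato solution `w` on `[0, c₀ν/B₀²)` from `a` with `‖w(t)‖_∞ ≤ 2B₀`.
3. **Kato solutions with `L²` datum are Leray–Hopf** (`IsKatoSolutionOn.isLerayHopfOn_of_memLp_two`;
   Escauriaza–Seregin–Šverák 2003, Rem. 7.5; Kato 1984, Thm. 4): `w` is Leray–Hopf on `[0, t]`,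
   `0 < t < c₀ν/B₀²` (Kato's smoothing hypothesis `‖w(s)‖_∞ ≤ C/√s` holds with
   `C = 2B₀ √(c₀ν/B₀²)`).
4. **Weak–strong uniqueness** in the Serrin class `q = r = ∞`
   (`serrin_weak_strong_uniqueness_holds`; Prodi 1959, Serrin 1963): `u(s) = w(s)` a.e. for
   `s ∈ (0, t]`, in particular `‖u(t, ·)‖ ≤ 2B₀` a.e.; the exceptional set is open (continuity of
   the classical slice) and null, hence empty (`forall_norm_le_of_ae_norm_le`).

## References

* P. G. Lemarié-Rieusset, *The Navier–Stokes Problem in the 21st Century*, CRC Press 2016,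
  doi:10.1201/b19556, Thm. 5.1 (pp. 103–105), §9.9 (p. 260). [LemarieRieusset2016]
* T. Kato, Math. Z. 187 (1984) 471–480, Thms. 1, 4. [Kato1984]
* Y. Giga, K. Inui, S. Matsui, Quaderni di Matematica 4 (1999) (the `L^∞` local theory, lifespan
  `≥ c/‖u₀‖_∞²`).
* J. Serrin, in *Nonlinear Problems* (1963), Thm. 6; G. Prodi, Ann. Mat. Pura Appl. 48 (1959).
  [Prodi1959]
-/

noncomputable section

open MeasureTheory Set Function Filter Topology
open scoped ENNReal NNReal

namespace Literature.Analysis.FluidPDE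

/-- **`L² ∩ L^∞ ⊆ L³`, quantitatively**: an a.e.-strongly measurable field with `‖a‖ ≤ B` pointwise
and `a ∈ L²` lies in `L³` (`∫ ‖a‖³ ≤ B ∫ ‖a‖²`). [folklore] -/
theorem memLp_three_of_memLp_two_of_norm_le
    {a : EuclideanSpace ℝ (Fin 3) → EuclideanSpace ℝ (Fin 3)} (ha2 : MemLp a 2 volume) {B : ℝ}
    (hB : ∀ x, ‖a x‖ ≤ B) : MemLp a 3 volume := by
  have hmeas : AEStronglyMeasurable a volume := ha2.1
  have hess : eLpNormEssSup a volume ≤ ENNReal.ofReal B :=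
    eLpNormEssSup_le_of_ae_bound (Eventually.of_forall hB)
  have h2 : ∫⁻ x, ‖a x‖ₑ ^ 2 < ∞ := by
    have := lintegral_rpow_enorm_lt_top_of_eLpNorm_lt_top (by norm_num) (by norm_num)
      ha2.eLpNorm_lt_top
    simpa [ENNReal.toReal_ofNat, ENNReal.rpow_two] using this
  have h12 := lintegral_enorm_pow_add_le_essSup_pow_mul (μ := volume) hmeas 1 2
  have h3 : ∫⁻ x, ‖a x‖ₑ ^ 3 < ∞ := by
    refine h12.trans_lt (ENNReal.mul_lt_top ?_ h2)
    rw [pow_one]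
    exact hess.trans_lt ENNReal.ofReal_lt_top
  refine ⟨hmeas, ?_⟩
  rw [eLpNorm_eq_lintegral_rpow_enorm_toReal (by norm_num) (by norm_num), ENNReal.toReal_ofNat]
  refine ENNReal.rpow_lt_top_of_nonneg (by norm_num) (ne_of_lt ?_)
  have h3' : ∫⁻ x, ‖a x‖ₑ ^ (3 : ℝ) = ∫⁻ x, ‖a x‖ₑ ^ 3 := by
    refine lintegral_congr fun x => ?_
    rw [show (3 : ℝ) = ((3 : ℕ) : ℝ) by norm_num, ENNReal.rpow_natCast]
  rw [h3']
  exact h3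

/-- **The early window (quantitative short-time `L^∞` bound for classical Leray–Hopf solutions).**
There is an absolute constant `c₀ > 0` such that: for `ν > 0`, `T > 0`, every classical solution
`(u, p)` of the unforced Navier–Stokes system on `ℝ³ × [0, T)` which is a Leray–Hopf weak solution
on `[0, T)` from `u 0`, and every `B₀ > 0` with `‖u(0, x)‖ ≤ B₀` for all `x`, one has
`‖u(t, x)‖ ≤ 2B₀` for all `x` whenever `t ∈ [0, T)` and `t < c₀ ν / B₀²` (Kato–Oseen local theory
for bounded data, Lemarié-Rieusset 2016 Thm. 5.1/§9.9, + Kato solutions are Leray–Hopf, ESS 2003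
Rem. 7.5, + weak–strong uniqueness, Prodi–Serrin). The lifespan `c₀ν/B₀²` is dictated by the
scaling. [cite: LemarieRieusset2016, Thm. 5.1 (p. 103), §9.9 (p. 260)] -/
theorem exists_earlyWindow_norm_le :
    ∃ c₀ : ℝ, 0 < c₀ ∧ ∀ (ν T : ℝ) (u : ℝ → EuclideanSpace ℝ (Fin 3) → EuclideanSpace ℝ (Fin 3))
      (p : ℝ → EuclideanSpace ℝ (Fin 3) → ℝ), 0 < ν → 0 < T →
      IsClassicalNSSolutionOn (Ico 0 T) ν 0 u p → IsLerayHopfOn T ν 0 (u 0) u →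
      ∀ B₀ : ℝ, 0 < B₀ → (∀ x, ‖u 0 x‖ ≤ B₀) →
      ∀ t ∈ Ico 0 T, t < c₀ * ν / B₀ ^ 2 → ∀ x, ‖u t x‖ ≤ 2 * B₀ := by
  obtain ⟨c₀, hc₀, hK⟩ := kato_local_bounded_holds
  refine ⟨c₀, hc₀, ?_⟩
  intro ν T u p hν hT hcl hLH B₀ hB₀ hbd t ht htc x
  rcases eq_or_lt_of_le ht.1 with h0 | htpos
  · -- `t = 0`
    rw [← h0]
    linarith [hbd x, norm_nonneg (u 0 x)]
  -- the datum
  have ha2 : MemLp (u 0) 2 volume := hLH.memLp 0 ⟨le_rfl, hT.le⟩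
  have ha3 : MemLp (u 0) 3 volume := memLp_three_of_memLp_two_of_norm_le ha2 hbd
  have hdiv : IsWeaklyDivFree (u 0) := hLH.isWeaklyDivFree_datum hT
  have hatop : eLpNorm (u 0) ∞ volume ≤ ENNReal.ofReal B₀ := by
    rw [eLpNorm_exponent_top]
    exact eLpNormEssSup_le_of_ae_bound (Eventually.of_forall hbd)
  -- Kato–Oseen: a bounded mild solution on `[0, T₁)`, `T₁ = c₀ ν / B₀²`
  obtain ⟨w, hw, hwbd⟩ := hK hν hB₀ ha3 hdiv hatop
  set T₁ : ℝ := c₀ * ν / B₀ ^ 2 with hT₁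
  have htT₁ : t < T₁ := htc
  have hT₁pos : 0 < T₁ := htpos.trans htT₁
  -- `w` is Leray–Hopf on `[0, t]`
  have hinf : ∀ s ∈ Ioo 0 T₁, eLpNorm (w s) ∞ volume ≤
      ENNReal.ofReal (2 * B₀ * Real.sqrt T₁ / Real.sqrt s) := by
    intro s hs
    refine (hwbd s ⟨hs.1.le, hs.2⟩).trans (ENNReal.ofReal_le_ofReal ?_)
    rw [le_div_iff₀ (Real.sqrt_pos.2 hs.1)]
    exact mul_le_mul_of_nonneg_left (Real.sqrt_le_sqrt hs.2.le) (by positivity)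
  obtain ⟨hLHw, -⟩ := hw.isLerayHopfOn_of_memLp_two hν ha2 hinf htT₁ htpos
  -- `w ∈ L^∞(0, t; L^∞)`
  have hS : MemLqLp ∞ ∞ w (Ioo 0 t) := by
    refine memLqLp_of_ae_eLpNorm_le (C := ENNReal.ofReal (2 * B₀)) ENNReal.ofReal_ne_top
      (by rw [Real.volume_Ioo]; exact ENNReal.ofReal_ne_top) ?_ ?_
    · exact (ae_restrict_iff' measurableSet_Ioo).2 (Eventually.of_forall fun s hs =>
        ⟨(hw.memLp ⟨hs.1.le, hs.2.trans htT₁⟩).1,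
          (hwbd s ⟨hs.1.le, hs.2.trans htT₁⟩).trans_lt ENNReal.ofReal_lt_top⟩)
    · exact (ae_restrict_iff' measurableSet_Ioo).2 (Eventually.of_forall fun s hs =>
        hwbd s ⟨hs.1.le, hs.2.trans htT₁⟩)
  -- weak–strong uniqueness: `u = w` a.e. on `(0, t]`
  have huniq := serrin_weak_strong_uniqueness_holds hν htpos hLHw ha2 (q := ⊤) (r := ⊤)
    (by simp) (by simp) hS (hLH.of_le ht.2.le)
  have hae : u t =ᵐ[volume] w t := huniq t ⟨htpos, le_rfl⟩
  -- the a.e. bound for `u t`, then everywhere by continuity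
  have hwt : ∀ᵐ y ∂(volume : Measure (EuclideanSpace ℝ (Fin 3))),
      ‖w t y‖ₑ ≤ ENNReal.ofReal (2 * B₀) := by
    have h1 : eLpNormEssSup (w t) volume ≤ ENNReal.ofReal (2 * B₀) := by
      rw [← eLpNorm_exponent_top]; exact hwbd t ⟨htpos.le, htT₁⟩
    filter_upwards [ae_le_eLpNormEssSup (μ := volume) (f := w t)] with y hy
    exact hy.trans h1
  have hut : ∀ᵐ y ∂(volume : Measure (EuclideanSpace ℝ (Fin 3))), ‖u t y‖ ≤ 2 * B₀ := by
    filter_upwards [hae, hwt] with y hy hwy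
    rw [← ofReal_norm, ENNReal.ofReal_le_ofReal_iff (by positivity)] at hwy
    rw [hy]
    exact hwy
  exact forall_norm_le_of_ae_norm_le (hcl.contDiff_velocity ht).continuous hut x

end Literature.Analysis.FluidPDE

end
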